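import Summits.CriticalPhenomena.PercolationContinuityZ3.Theorems.PercNearOneGluingNoHeavyLowerTailSahiE3LayerCake
import Summits.CriticalPhenomena.PercolationContinuityZ3.Theorems.PercNearOneGluingNoHeavyLowerTailSahiE3BlockKernel
import Mathlib.Tactic.Linarith
import Mathlib.Tactic.Ring
import Mathlib.Tactic.Positivity
import HarnessLib
import HarnessLib.Audit

/-!
# `NoHeavyLowerTail` (crux stmt-CriticalPhenomena-4575), Sahi programme P4: the pair inequality of the principal block OR-step
# (block OR-step, file 3 — the analytic heart, in section-profile form)

Support file (cell `prim-l12`, seat P4, generation 15; `--supports stmt-CriticalPhenomena-4575`).  No named facts, no sorries;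
standard axioms; def-free.

Setting (normalised): a finite poset `Q` with a weight `ν' ≥ 0` of total mass `1` satisfying Harris' inequality for up-sets, an
up-set `G` (`u' = ν'(G)`, `d' = 1 − u'`) with the retained mass `R' ≥ 0` of an exact flow certificate (`R' ≤ (1+d')ν'` on `G` and the
pair inequality `ν'(V)ν'(W∩G) + ν'(W)ν'(V∩G) − u'ν'(V)ν'(W) ≤ R'(V∩W∩G)` for up-sets), and numbers `p, q ≥ 0`, `p + q = 1` (the weight
of the top of the block and of its complement).  A pair of up-sets `S, S'` of `B × Q` (block `B` with top `t`, Harris weights `w`)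
enters ONLY through its SECTION PROFILES on `Q`: `a = 1_{S_t}`, `f(s) = w{β ≠ t | (β,s) ∈ S}`, `h(s) = w{β ≠ t | (β,s) ∈ S ∩ S'}`
(monotone, `0 ≤ f ≤ q a`, `0 ≤ h ≤ f, f'`) and Harris on the block pointwise: `(pa+f)(pa'+f') ≤ p·aa' + h`.
THEOREM `block_pair`: the pair inequality `need(S,S') ≤ R(S ∩ S' ∩ U)` of the flat composite certificate of
`U = {t} × Q ∪ B × G`, written in profile form.  Proof (HOME prim-l12-p4/FROM-prim-l12-p4-gen15-BLOCK-OR-STEP.md): the identity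
`Φ = T_H + T_d + mid + P`; `T_H ≥ 0` (Harris on `Q`); `mid ≥ M₁` (one-dimensional layer cake + `hb_m0_ge`); (N) `P ≥ −(1+d')M₁`
(two-dimensional layer cake with the kernel `xy`, the cap and `hb_excess_le`); (N') `d'P + (1+d')T_d ≥ 0` (two-dimensional layer
cake with the kernel `(xy − p(q−x)(q−y))⁺` and `hb_kernel_le`, the defect bounded by `mul_sub_kernel_le'`); sum.
-/

namespace Summit.CriticalPhenomena.PercolationContinuityZ3.Theorems.SahiE3BlockPair

open Finset SahiE3LayerCake SahiE3BlockKernel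
open scoped BigOperators

variable {Q : Type*} [Fintype Q] [DecidableEq Q]

/-! ### Sum bookkeeping -/

omit [DecidableEq Q] in
/-- Sum of a `{0,1}`-valued profile: `Σ ν'·a·F = Σ_{a = 1} ν'·F`. [folklore] -/
theorem sum_mul_binary (ν' F a : Q → ℝ) (ha : ∀ s, a s = 0 ∨ a s = 1) :
    ∑ s, ν' s * (a s * F s) = ∑ s ∈ univ.filter (fun s => a s = 1), ν' s * F s := by
  rw [Finset.sum_filter]
  refine Finset.sum_congr rfl fun s _ => ?_
  rcases ha s with h | h <;> simp [h]

omit [DecidableEq Q] in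
/-- Mass of the support of a `{0,1}`-valued profile. [folklore] -/
theorem sum_binary (ν' a : Q → ℝ) (ha : ∀ s, a s = 0 ∨ a s = 1) :
    ∑ s, ν' s * a s = ∑ s ∈ univ.filter (fun s => a s = 1), ν' s := by
  have := sum_mul_binary ν' (fun _ => (1:ℝ)) a ha
  simpa using this

omit [Fintype Q] in
/-- The bilinear form `n` on rectangles: `Σ_{V} Σ_{W} ν'ν'(1_G + 1_G' − u') = ν'(V)ν'(W∩G) + ν'(V∩G)ν'(W) − u'ν'(V)ν'(W)`. [this work] -/
theorem nform_rect (ν' : Q → ℝ) (G V W : Finset Q) (u' : ℝ) :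
    ∑ s ∈ V, ∑ s' ∈ W, ν' s * ν' s' * ((if s ∈ G then (1:ℝ) else 0) + (if s' ∈ G then (1:ℝ) else 0) - u') =
      (∑ s ∈ V, ν' s) * (∑ s ∈ W ∩ G, ν' s) + (∑ s ∈ V ∩ G, ν' s) * (∑ s ∈ W, ν' s)
        - u' * ((∑ s ∈ V, ν' s) * (∑ s ∈ W, ν' s)) := by
  have e1 : ∀ X : Finset Q, ∑ s ∈ X ∩ G, ν' s = ∑ s ∈ X, ν' s * (if s ∈ G then (1:ℝ) else 0) := by
    intro X
    rw [← Finset.filter_mem_eq_inter, Finset.sum_filter]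
    exact Finset.sum_congr rfl fun s _ => by split_ifs <;> simp
  rw [e1, e1, Finset.sum_mul_sum, Finset.sum_mul_sum, Finset.sum_mul_sum, Finset.mul_sum, ← Finset.sum_add_distrib,
    ← Finset.sum_sub_distrib]
  refine Finset.sum_congr rfl fun s _ => ?_
  rw [Finset.mul_sum, ← Finset.sum_add_distrib, ← Finset.sum_sub_distrib]
  exact Finset.sum_congr rfl fun s' _ => by ring

/-- The bilinear form `n` on profiles: `Σ_s Σ_{s'} ν'ν'(1_G + 1_G' − u') φ(s)ψ(s') = ν'(φ)ν'(ψ1_G) + ν'(φ1_G)ν'(ψ) − u'ν'(φ)ν'(ψ)`.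
[this work] -/
theorem nform_fun (ν' : Q → ℝ) (G : Finset Q) (u' : ℝ) (φ ψ : Q → ℝ) :
    ∑ s, ∑ s', ν' s * ν' s' * ((if s ∈ G then (1:ℝ) else 0) + (if s' ∈ G then (1:ℝ) else 0) - u') * (φ s * ψ s') =
      (∑ s, ν' s * φ s) * (∑ s ∈ G, ν' s * ψ s) + (∑ s ∈ G, ν' s * φ s) * (∑ s, ν' s * ψ s)
        - u' * ((∑ s, ν' s * φ s) * (∑ s, ν' s * ψ s)) := by
  have e1 : ∀ F : Q → ℝ, ∑ s ∈ G, ν' s * F s = ∑ s, ν' s * F s * (if s ∈ G then (1:ℝ) else 0) := by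
    intro F
    rw [← sum_ite_mem_univ G]
    exact Finset.sum_congr rfl fun s _ => by split_ifs <;> simp
  rw [e1, e1, Finset.sum_mul_sum, Finset.sum_mul_sum, Finset.sum_mul_sum, Finset.mul_sum, ← Finset.sum_add_distrib,
    ← Finset.sum_sub_distrib]
  refine Finset.sum_congr rfl fun s _ => ?_
  rw [Finset.mul_sum, ← Finset.sum_add_distrib, ← Finset.sum_sub_distrib]
  exact Finset.sum_congr rfl fun s' _ => by ring

omit [DecidableEq Q] in
/-- Product of two plain sums as a double sum. [folklore] -/
theorem prod_as_dsum (ν' : Q → ℝ) (φ ψ : Q → ℝ) :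
    (∑ s, ν' s * φ s) * (∑ s, ν' s * ψ s) = ∑ s, ∑ s', ν' s * ν' s' * (φ s * ψ s') := by
  rw [Finset.sum_mul_sum]
  refine Finset.sum_congr rfl fun s _ => Finset.sum_congr rfl fun s' _ => by ring

variable [PartialOrder Q]

omit [DecidableEq Q] in
/-- The support `{a = 1}` of a monotone `{0,1}`-valued profile is an up-set. [folklore] -/
theorem isUpperSet_support {a : Q → ℝ} (ha : ∀ s, a s = 0 ∨ a s = 1) (hm : Monotone a) :
    IsUpperSet ((univ.filter fun s => a s = 1 : Finset Q) : Set Q) := by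
  intro s s' hss' hs
  simp only [coe_filter, mem_univ, true_and, Set.mem_setOf_eq] at hs ⊢
  have h1 : (1:ℝ) ≤ a s' := hs ▸ hm hss'
  rcases ha s' with h | h
  · rw [h] at h1; exact absurd h1 (by norm_num)
  · exact h

omit [Fintype Q] in
/-- An increasing profile restricted to an up-set `G` (extended by `0`) is increasing. [folklore] -/
theorem monotone_restrict {G : Finset Q} (hG : IsUpperSet (G : Set Q)) {ψ : Q → ℝ} (hψ : Monotone ψ)
    (hψ0 : ∀ s, 0 ≤ ψ s) : Monotone (fun s => if s ∈ G then ψ s else 0) := by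
  intro s s' hss'
  dsimp only
  by_cases hs : s ∈ G
  · have hs' : s' ∈ G := hG hss' hs
    rw [if_pos hs, if_pos hs']; exact hψ hss'
  · rw [if_neg hs]; split_ifs
    · exact hψ0 s'
    · exact le_rfl

/-- Harris with a profile: `ν'(V) · ν'(ψ 1_G) ≤ Σ_{V ∩ G} ν' ψ` for an up-set `V` and increasing `ψ ≥ 0` (total mass `1`). [this work] -/
theorem harris_profile {ν' : Q → ℝ} (hH : ∀ V W : Finset Q, IsUpperSet (V : Set Q) → IsUpperSet (W : Set Q) →
      (∑ s ∈ V, ν' s) * (∑ s ∈ W, ν' s) ≤ ∑ s ∈ V ∩ W, ν' s)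
    {G : Finset Q} (hG : IsUpperSet (G : Set Q)) (V : Finset Q) (hV : IsUpperSet (V : Set Q))
    {ψ : Q → ℝ} (hψ : Monotone ψ) (hψ0 : ∀ s, 0 ≤ ψ s) :
    (∑ s ∈ V, ν' s) * (∑ s ∈ G, ν' s * ψ s) ≤ ∑ s ∈ V ∩ G, ν' s * ψ s := by
  have key := layer_cake₁ (fun s s' => ν' s * ν' s') ν'
    (fun V W hV hW => by rw [← Finset.sum_mul_sum]; exact hH V W hV hW) V hV
    (fun s => if s ∈ G then ψ s else 0) (monotone_restrict hG hψ hψ0)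
    (fun s => by split_ifs; exacts [hψ0 s, le_rfl])
  have eL : ∑ s ∈ V, ∑ s', ν' s * ν' s' * (if s' ∈ G then ψ s' else 0) = (∑ s ∈ V, ν' s) * ∑ s ∈ G, ν' s * ψ s := by
    rw [Finset.sum_mul]
    refine Finset.sum_congr rfl fun s _ => ?_
    rw [Finset.mul_sum, ← sum_ite_mem_univ G]
    exact Finset.sum_congr rfl fun s' _ => by split_ifs <;> ring
  have eR : ∑ s ∈ V, ν' s * (if s ∈ G then ψ s else 0) = ∑ s ∈ V ∩ G, ν' s * ψ s := by
    rw [← Finset.filter_mem_eq_inter, Finset.sum_filter]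
    exact Finset.sum_congr rfl fun s _ => by split_ifs <;> simp
  rw [eL, eR] at key
  exact key

/-! ### The pair inequality in profile form -/

omit [Fintype Q] [DecidableEq Q] [PartialOrder Q] in
/-- Filtering a set by the support of a binary profile. [folklore] -/
theorem sum_mul_binary_on (X : Finset Q) (ν' F a : Q → ℝ) (ha : ∀ s, a s = 0 ∨ a s = 1) :
    ∑ s ∈ X, ν' s * (a s * F s) = ∑ s ∈ X.filter (fun s => a s = 1), ν' s * F s := by
  rw [Finset.sum_filter]
  refine Finset.sum_congr rfl fun s _ => ?_
  rcases ha s with h | h <;> simp [h]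

set_option maxHeartbeats 1600000 in
/-- **Pair inequality of the principal block OR-step (profile form).**  See the module docstring for the setting; the
conclusion is `need(S,S') ≤ R(S ∩ S' ∩ U)` for the flat composite certificate, both sides written through the section
profiles `a, f, h, a', f'` (`A₁ = ν'(a)`, `F₁ = ν'(f)`, `F_G = ν'(f 1_G)`, …). [this work] -/
theorem block_pair {ν' R' : Q → ℝ} (hν' : ∀ s, 0 ≤ ν' s) (hZ : ∑ s, ν' s = 1)
    (hH : ∀ V W : Finset Q, IsUpperSet (V : Set Q) → IsUpperSet (W : Set Q) →
      (∑ s ∈ V, ν' s) * (∑ s ∈ W, ν' s) ≤ ∑ s ∈ V ∩ W, ν' s)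
    {G : Finset Q} (hG : IsUpperSet (G : Set Q)) (hR'0 : ∀ s ∈ G, 0 ≤ R' s)
    (hR'cap : ∀ s ∈ G, R' s ≤ (1 + ∑ r ∈ Gᶜ, ν' r) * ν' s)
    (hpair' : ∀ V W : Finset Q, IsUpperSet (V : Set Q) → IsUpperSet (W : Set Q) →
      ((∑ s ∈ V, ν' s) * (∑ s ∈ W ∩ G, ν' s) + (∑ s ∈ W, ν' s) * (∑ s ∈ V ∩ G, ν' s))
        - (∑ s ∈ G, ν' s) * (∑ s ∈ V, ν' s) * (∑ s ∈ W, ν' s) ≤ ∑ s ∈ (V ∩ W) ∩ G, R' s)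
    {p q : ℝ} (hp : 0 ≤ p) (hq : 0 ≤ q) (hpq : p + q = 1)
    {a f h a' f' : Q → ℝ} (ha : ∀ s, a s = 0 ∨ a s = 1) (ha' : ∀ s, a' s = 0 ∨ a' s = 1)
    (ham : Monotone a) (ha'm : Monotone a') (hfm : Monotone f) (hf'm : Monotone f')
    (hf0 : ∀ s, 0 ≤ f s) (hfa : ∀ s, f s ≤ q * a s) (hf0' : ∀ s, 0 ≤ f' s) (hfa' : ∀ s, f' s ≤ q * a' s)
    (hh0 : ∀ s, 0 ≤ h s) (hhf : ∀ s, h s ≤ f s) (hhf' : ∀ s, h s ≤ f' s)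
    (hB : ∀ s, (p * a s + f s) * (p * a' s + f' s) ≤ p * (a s * a' s) + h s) :
    ((p * ∑ s, ν' s * a s + ∑ s, ν' s * f s) * (p * ∑ s, ν' s * a' s + ∑ s ∈ G, ν' s * f' s)
      + (p * ∑ s, ν' s * a' s + ∑ s, ν' s * f' s) * (p * ∑ s, ν' s * a s + ∑ s ∈ G, ν' s * f s))
      - (p + q * ∑ s ∈ G, ν' s) *
        ((p * ∑ s, ν' s * a s + ∑ s, ν' s * f s) * (p * ∑ s, ν' s * a' s + ∑ s, ν' s * f' s))
    ≤ p * (1 + q * (1 - ∑ s ∈ G, ν' s)) * ∑ s ∈ G, ν' s * (a s * a' s)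
      + p * (p + q * (1 - ∑ s ∈ G, ν' s)) * (∑ s, ν' s * (a s * a' s) - ∑ s ∈ G, ν' s * (a s * a' s))
      + p * ∑ s ∈ G, ν' s * h s + q * ∑ s ∈ G, R' s * h s := by
  -- `q = 1 - p`
  have hq1 : q = 1 - p := by linarith
  subst hq1
  have hp1 : p ≤ 1 := by linarith
  -- elementary pointwise bounds
  have ha1 : ∀ s, a s ≤ 1 := fun s => by rcases ha s with h | h <;> simp [h]
  have ha0 : ∀ s, 0 ≤ a s := fun s => by rcases ha s with h | h <;> simp [h]
  have ha1' : ∀ s, a' s ≤ 1 := fun s => by rcases ha' s with h | h <;> simp [h]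
  have ha0' : ∀ s, 0 ≤ a' s := fun s => by rcases ha' s with h | h <;> simp [h]
  have hfq : ∀ s, f s ≤ 1 - p := fun s => (hfa s).trans (by nlinarith [ha1 s])
  have hfq' : ∀ s, f' s ≤ 1 - p := fun s => (hfa' s).trans (by nlinarith [ha1' s])
  -- abbreviations
  obtain ⟨u', hu'⟩ : ∃ x, ∑ s ∈ G, ν' s = x := ⟨_, rfl⟩
  have hu'0 : 0 ≤ u' := hu' ▸ Finset.sum_nonneg fun s _ => hν' s
  have hu'1 : u' ≤ 1 := by rw [← hu', ← hZ]; exact Finset.sum_le_univ_sum_of_nonneg hν'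
  have hGc : ∑ r ∈ Gᶜ, ν' r = 1 - u' := by
    have := Finset.sum_add_sum_compl G ν'; rw [hZ, hu'] at this; linarith
  rw [hGc] at hR'cap
  rw [hu'] at hpair'
  obtain ⟨A₁, hA₁⟩ : ∃ x, ∑ s, ν' s * a s = x := ⟨_, rfl⟩
  obtain ⟨B₁, hB₁⟩ : ∃ x, ∑ s, ν' s * a' s = x := ⟨_, rfl⟩
  obtain ⟨F₁, hF₁⟩ : ∃ x, ∑ s, ν' s * f s = x := ⟨_, rfl⟩
  obtain ⟨E₁, hE₁⟩ : ∃ x, ∑ s, ν' s * f' s = x := ⟨_, rfl⟩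
  obtain ⟨FG, hFG⟩ : ∃ x, ∑ s ∈ G, ν' s * f s = x := ⟨_, rfl⟩
  obtain ⟨EG, hEG⟩ : ∃ x, ∑ s ∈ G, ν' s * f' s = x := ⟨_, rfl⟩
  obtain ⟨AA, hAA⟩ : ∃ x, ∑ s, ν' s * (a s * a' s) = x := ⟨_, rfl⟩
  obtain ⟨AAG, hAAG⟩ : ∃ x, ∑ s ∈ G, ν' s * (a s * a' s) = x := ⟨_, rfl⟩
  obtain ⟨HG, hHG⟩ : ∃ x, ∑ s ∈ G, ν' s * h s = x := ⟨_, rfl⟩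
  obtain ⟨RH, hRH⟩ : ∃ x, ∑ s ∈ G, R' s * h s = x := ⟨_, rfl⟩
  obtain ⟨MG, hMG⟩ : ∃ x, ∑ s ∈ G, ν' s * (a s * a' s * (((1 - p) - f s) * ((1 - p) - f' s))) = x := ⟨_, rfl⟩
  rw [hu', hA₁, hB₁, hF₁, hE₁, hFG, hEG, hAA, hAAG, hHG, hRH]
  -- the supports
  set Va : Finset Q := univ.filter fun s => a s = 1 with hVa
  set Vb : Finset Q := univ.filter fun s => a' s = 1 with hVb
  have uVa : IsUpperSet (Va : Set Q) := isUpperSet_support ha ham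
  have uVb : IsUpperSet (Vb : Set Q) := isUpperSet_support ha' ha'm
  have eA₁ : ∑ s ∈ Va, ν' s = A₁ := by rw [← hA₁, sum_binary ν' a ha]
  have eB₁ : ∑ s ∈ Vb, ν' s = B₁ := by rw [← hB₁, sum_binary ν' a' ha']
  have filt : ∀ (X : Finset Q) (c : Q → ℝ), X.filter (fun s => c s = 1) = univ.filter (fun s => c s = 1) ∩ X := by
    intro X c; ext s; simp [and_comm]
  -- (T_H)  `A₁ B₁ ≤ AA`  (Harris on `Q`)
  have hTH : A₁ * B₁ ≤ AA := by
    have e : ∑ s ∈ Va ∩ Vb, ν' s = AA := by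
      rw [← hAA, sum_mul_binary_on univ ν' a' a ha, ← hVa]
      have : ∑ s ∈ Va, ν' s * a' s = ∑ s ∈ Va.filter (fun s => a' s = 1), ν' s := by
        have := sum_mul_binary_on Va ν' (fun _ => (1:ℝ)) a' ha'; simpa using this
      rw [this, filt Va a', ← hVb, Finset.inter_comm]
    rw [← eA₁, ← eB₁, ← e]; exact hH Va Vb uVa uVb
  -- (mid ≥ M₁)
  have hm1 : A₁ * EG ≤ ∑ s ∈ G, ν' s * (a s * f' s) := by
    have k := harris_profile hH hG Va uVa hf'm hf0'
    rw [eA₁, hEG] at k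
    refine k.trans (le_of_eq ?_)
    rw [sum_mul_binary_on G ν' f' a ha, filt G a, ← hVa]
  have hm2 : B₁ * FG ≤ ∑ s ∈ G, ν' s * (a' s * f s) := by
    have k := harris_profile hH hG Vb uVb hfm hf0
    rw [eB₁, hFG] at k
    refine k.trans (le_of_eq ?_)
    rw [sum_mul_binary_on G ν' f a' ha', filt G a', ← hVb]
  have hm3 : p * MG ≤ p * ((1 - p) * AAG + HG - ∑ s ∈ G, ν' s * (a s * f' s) - ∑ s ∈ G, ν' s * (a' s * f s)) := by
    refine mul_le_mul_of_nonneg_left ?_ hp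
    rw [← hMG, ← hAAG, ← hHG, Finset.mul_sum, ← Finset.sum_add_distrib, ← Finset.sum_sub_distrib, ← Finset.sum_sub_distrib]
    refine Finset.sum_le_sum fun s _ => ?_
    have k := hb_m0_ge hp (by ring) (ha s) (ha' s) (hf0 s) (hfa s) (hf0' s) (hfa' s) (hh0 s) (hhf s) (hhf' s) (hB s)
    have := mul_le_mul_of_nonneg_left k (hν' s)
    nlinarith [this]
  -- the bilinear form `A_G` and the diagonal weights `ρ`
  set AG : Q → Q → ℝ := fun s s' => ν' s * ν' s' * ((if s ∈ G then (1:ℝ) else 0) + (if s' ∈ G then (1:ℝ) else 0) - u')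
    with hAGdef
  set ρ : Q → ℝ := fun s => if s ∈ G then R' s else 0 with hρdef
  have hrect : ∀ V W : Finset Q, IsUpperSet (V : Set Q) → IsUpperSet (W : Set Q) →
      ∑ s ∈ V, ∑ s' ∈ W, AG s s' ≤ ∑ s ∈ V ∩ W, ρ s := by
    intro V W hV hW
    rw [hAGdef, nform_rect ν' G V W u']
    have eρ : ∑ s ∈ V ∩ W, ρ s = ∑ s ∈ (V ∩ W) ∩ G, R' s := by
      rw [hρdef]; dsimp only; rw [← Finset.sum_filter, Finset.filter_mem_eq_inter]
    rw [eρ]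
    have := hpair' V W hV hW
    rw [Finset.inter_comm V G] at this ⊢
    linarith [this]
  have eρsum : ∀ F : Q → ℝ, ∑ s, ρ s * F s = ∑ s ∈ G, R' s * F s := by
    intro F
    rw [← sum_ite_mem_univ G]
    exact Finset.sum_congr rfl fun s _ => by rw [hρdef]; dsimp only; split_ifs <;> simp
  -- the form applied to `f ⊗ f'`
  have eNFF : ∑ s, ∑ s', AG s s' * (f s * f' s') = F₁ * EG + FG * E₁ - u' * (F₁ * E₁) := by
    rw [hAGdef, nform_fun ν' G u' f f', hF₁, hE₁, hFG, hEG]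
  -- (N): the form against the kernel `xy`
  have hN1 : ∑ s, ∑ s', AG s s' * (f s * f' s') ≤ ∑ s ∈ G, R' s * (f s * f' s) := by
    have k := layer_cake₂ AG ρ hrect (fun x y => x * y) (cf := 1 - p) (cg := 1 - p)
      (fun y _ _ => by simp) (fun x₁ x₂ y _ hx _ hy _ => by nlinarith)
      (fun x₁ x₂ y₁ y₂ _ hx _ _ hy _ => by nlinarith) f f' hfm hf'm hf0 hfq hf0' hfq'
    rw [eρsum] at k
    exact k
  have hN2 : ∑ s ∈ G, R' s * (f s * f' s) - (1 - p) * RH ≤ (1 + (1 - u')) * (p * MG) := by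
    rw [← hRH, ← hMG, Finset.mul_sum, Finset.mul_sum, ← Finset.sum_sub_distrib, Finset.mul_sum]
    refine Finset.sum_le_sum fun s hs => ?_
    have ex := hb_excess_le hp (by linarith) (by ring) (ha s) (ha' s) (hf0 s) (hfa s) (hf0' s) (hfa' s) (hh0 s) (hB s)
    have r0 := hR'0 s hs
    have rc := hR'cap s hs
    have m0 : 0 ≤ max (f s * f' s - (1 - p) * h s) 0 := le_max_right _ _
    have m1 : f s * f' s - (1 - p) * h s ≤ max (f s * f' s - (1 - p) * h s) 0 := le_max_left _ _
    have s1 : R' s * (f s * f' s - (1 - p) * h s) ≤ R' s * max (f s * f' s - (1 - p) * h s) 0 :=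
      mul_le_mul_of_nonneg_left m1 r0
    have s2 : R' s * max (f s * f' s - (1 - p) * h s) 0 ≤ ((1 + (1 - u')) * ν' s) * max (f s * f' s - (1 - p) * h s) 0 :=
      mul_le_mul_of_nonneg_right rc m0
    have s3 : ((1 + (1 - u')) * ν' s) * max (f s * f' s - (1 - p) * h s) 0 ≤
        ((1 + (1 - u')) * ν' s) * (p * (a s * a' s * (((1 - p) - f s) * ((1 - p) - f' s)))) :=
      mul_le_mul_of_nonneg_left ex (mul_nonneg (by linarith) (hν' s))
    nlinarith [s1, s2, s3]
  -- (N'): the form against the packing kernel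
  have hK1 : ∑ s, ∑ s', AG s s' * max (f s * f' s' - p * (((1 - p) - f s) * ((1 - p) - f' s'))) 0 ≤ (1 - p) * RH := by
    have k := layer_cake₂ AG ρ hrect (fun x y => max (x * y - p * (((1 - p) - x) * ((1 - p) - y))) 0)
      (cf := 1 - p) (cg := 1 - p)
      (fun y hy0 hy1 => kernel_zero_left hp hy0 hy1)
      (fun x₁ x₂ y _ hx _ hy0 hy1 => kernel_mono_left hp hx hy0 hy1)
      (fun x₁ x₂ y₁ y₂ hx0 hx hx1 hy0 hy hy1 => kernel_two_incr hp hp1 hx0 hx hx1 hy0 hy hy1)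
      f f' hfm hf'm hf0 hfq hf0' hfq'
    rw [eρsum] at k
    refine k.trans ?_
    rw [← hRH, Finset.mul_sum]
    refine Finset.sum_le_sum fun s hs => ?_
    have kk := hb_kernel_le hp (by linarith) (by ring) (ha s) (ha' s) (hf0 s) (hfa s) (hf0' s) (hfa' s) (hh0 s) (hB s)
    have := mul_le_mul_of_nonneg_left kk (hR'0 s hs)
    linarith
  have hK2 : ∑ s, ∑ s', AG s s' * (f s * f' s' - max (f s * f' s' - p * (((1 - p) - f s) * ((1 - p) - f' s'))) 0) ≤
      (1 + (1 - u')) * (p * (((1 - p) * A₁ - F₁) * ((1 - p) * B₁ - E₁))) := by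
    have eXY : ((1 - p) * A₁ - F₁) * ((1 - p) * B₁ - E₁) =
        ∑ s, ∑ s', ν' s * ν' s' * (((1 - p) * a s - f s) * ((1 - p) * a' s' - f' s')) := by
      rw [← prod_as_dsum, ← hA₁, ← hF₁, ← hB₁, ← hE₁, Finset.mul_sum, Finset.mul_sum, ← Finset.sum_sub_distrib,
        ← Finset.sum_sub_distrib]
      congr 1 <;> refine Finset.sum_congr rfl fun s _ => by ring
    rw [eXY, Finset.mul_sum, Finset.mul_sum]
    refine Finset.sum_le_sum fun s _ => ?_
    rw [Finset.mul_sum, Finset.mul_sum]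
    refine Finset.sum_le_sum fun s' _ => ?_
    have t0 : 0 ≤ f s * f' s' - max (f s * f' s' - p * (((1 - p) - f s) * ((1 - p) - f' s'))) 0 := by
      have := kernel_le_mul hp (hf0 s) (hfq s) (hf0' s') (hfq' s'); linarith
    have t1 := mul_sub_kernel_le' hp (by linarith : (0:ℝ) ≤ 1 - p) (ha s) (ha' s') (hf0 s) (hfa s) (hf0' s') (hfa' s')
    have c1 : AG s s' ≤ (1 + (1 - u')) * (ν' s * ν' s') := by
      rw [hAGdef]; dsimp only
      have : ((if s ∈ G then (1:ℝ) else 0) + (if s' ∈ G then (1:ℝ) else 0) - u') ≤ 1 + (1 - u') := by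
        split_ifs <;> linarith
      have := mul_le_mul_of_nonneg_left this (mul_nonneg (hν' s) (hν' s'))
      linarith
    have w0 : 0 ≤ (1 + (1 - u')) * (ν' s * ν' s') := mul_nonneg (by linarith) (mul_nonneg (hν' s) (hν' s'))
    calc AG s s' * (f s * f' s' - max (f s * f' s' - p * (((1 - p) - f s) * ((1 - p) - f' s'))) 0)
        ≤ ((1 + (1 - u')) * (ν' s * ν' s')) * (f s * f' s' - max (f s * f' s' - p * (((1 - p) - f s) * ((1 - p) - f' s'))) 0) :=
          mul_le_mul_of_nonneg_right c1 t0
      _ ≤ ((1 + (1 - u')) * (ν' s * ν' s')) * (p * (((1 - p) * a s - f s) * ((1 - p) * a' s' - f' s'))) :=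
          mul_le_mul_of_nonneg_left t1 w0
      _ = (1 + (1 - u')) * (p * (ν' s * ν' s' * (((1 - p) * a s - f s) * ((1 - p) * a' s' - f' s')))) := by ring
  have hsplit : ∑ s, ∑ s', AG s s' * (f s * f' s') =
      ∑ s, ∑ s', AG s s' * max (f s * f' s' - p * (((1 - p) - f s) * ((1 - p) - f' s'))) 0 +
      ∑ s, ∑ s', AG s s' * (f s * f' s' - max (f s * f' s' - p * (((1 - p) - f s) * ((1 - p) - f' s'))) 0) := by
    rw [← Finset.sum_add_distrib]
    refine Finset.sum_congr rfl fun s _ => ?_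
    rw [← Finset.sum_add_distrib]
    exact Finset.sum_congr rfl fun s' _ => by ring
  -- nonnegativity of the product term
  have hX0 : 0 ≤ (1 - p) * A₁ - F₁ := by
    rw [← hA₁, ← hF₁, Finset.mul_sum, ← Finset.sum_sub_distrib]
    exact Finset.sum_nonneg fun s _ => by nlinarith [hν' s, hfa s]
  have hY0 : 0 ≤ (1 - p) * B₁ - E₁ := by
    rw [← hB₁, ← hE₁, Finset.mul_sum, ← Finset.sum_sub_distrib]
    exact Finset.sum_nonneg fun s _ => by nlinarith [hν' s, hfa' s]
  have hMG0 : 0 ≤ MG := by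
    rw [← hMG]
    exact Finset.sum_nonneg fun s _ => mul_nonneg (hν' s) (mul_nonneg (mul_nonneg (ha0 s) (ha0' s))
      (mul_nonneg (by linarith [hfq s]) (by linarith [hfq' s])))
  -- assemble: (2 - u') Φ = (2-u') T_H + (2-u')(mid - M₁) + [P + (2-u') M₁] + (1-u')[P + (2-u') p XY]
  rw [eNFF] at hN1 hsplit
  have hd0 : 0 ≤ 1 - u' := by linarith
  have h2 : 0 < 1 + (1 - u') := by linarith
  -- name the remaining compound sums
  obtain ⟨SAF, hSAF⟩ : ∃ x, ∑ s ∈ G, ν' s * (a s * f' s) = x := ⟨_, rfl⟩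
  obtain ⟨SBF, hSBF⟩ : ∃ x, ∑ s ∈ G, ν' s * (a' s * f s) = x := ⟨_, rfl⟩
  obtain ⟨RFF, hRFF⟩ : ∃ x, ∑ s ∈ G, R' s * (f s * f' s) = x := ⟨_, rfl⟩
  obtain ⟨KK, hKK⟩ : ∃ x, ∑ s, ∑ s', AG s s' * max (f s * f' s' - p * (((1 - p) - f s) * ((1 - p) - f' s'))) 0 = x :=
    ⟨_, rfl⟩
  obtain ⟨TT, hTT⟩ : ∃ x,
      ∑ s, ∑ s', AG s s' * (f s * f' s' - max (f s * f' s' - p * (((1 - p) - f s) * ((1 - p) - f' s'))) 0) = x :=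
    ⟨_, rfl⟩
  rw [hSAF] at hm1 hm3
  rw [hSBF] at hm2 hm3
  rw [hRFF] at hN1 hN2
  rw [hKK] at hK1 hsplit
  rw [hTT] at hK2 hsplit
  have x1 : 0 ≤ (1 + (1 - u')) * (p * (p + (1 - p) * (1 - u')) * (AA - A₁ * B₁)) :=
    mul_nonneg h2.le (mul_nonneg (mul_nonneg hp (add_nonneg hp (mul_nonneg (by linarith) hd0))) (sub_nonneg.2 hTH))
  have x2 : 0 ≤ (1 + (1 - u')) * (p * (SAF - A₁ * EG) + p * (SBF - B₁ * FG)
      + (p * ((1 - p) * AAG + HG - SAF - SBF) - p * MG)) :=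
    mul_nonneg h2.le (add_nonneg (add_nonneg (mul_nonneg hp (sub_nonneg.2 hm1)) (mul_nonneg hp (sub_nonneg.2 hm2)))
      (sub_nonneg.2 hm3))
  have x3 : 0 ≤ (1 - u') * ((1 - p) * RH - (F₁ * EG + FG * E₁ - u' * (F₁ * E₁))
      + (1 + (1 - u')) * (p * (((1 - p) * A₁ - F₁) * ((1 - p) * B₁ - E₁)))) :=
    mul_nonneg hd0 (by linarith)
  rw [← sub_nonneg]
  refine (mul_nonneg_iff_of_pos_left h2).1 ?_
  linarith [x1, x2, x3, hN1, hN2]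

end Summit.CriticalPhenomena.PercolationContinuityZ3.Theorems.SahiE3BlockPair
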